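import Summits.Ventures.PercRepro.RankLevelSetRuleQCellFiveSliceThree
import Summits.Ventures.PercRepro.RankLevelSetRuleQCellSixSliceFour
import Summits.Ventures.PercRepro.RankLevelSetRuleQCellSevenSliceFive
import Summits.Ventures.PercRepro.RankLevelSetRuleQCellEightSliceSix
import Summits.Ventures.PercRepro.RankLevelSetRuleQCellNineSliceSeven
import Summits.Ventures.PercRepro.RankLevelSetRuleQCellTenSliceEight

/-!
# PercRepro — THE BORDERLINE SLICE `u = k − 2` OF EVERY CELL `(q+k, q)`, `k = 5 … 10`, IN ONE STATEMENT
(night-1, gen 17; dossier §28)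

The six slice theorems of the gen (`rhat_five_slice_three_all` … `rhat_ten_slice_eight_all`) bundled:
* **`rhat_borderline_of_le_ten`** — `Φ(q+k, q) ≤ R̂(q, k, q − (k − 2))` for every `5 ≤ k ≤ 10` and every `q ≥ k − 2`;
* **`ruleQRecv_ge_phiK_borderline`** — the matroid level: at the tight layer `#E = (q+k) + q` of every finite matroid,
  every member `Z` of the cell `(q+k, q)` with `#P = q − (k − 2)` (`P = flatPart M Z`) receives at least `Φ(q+k, q)`
  under Rule Q's equal split (`rhat_le_ruleQRecv`), `5 ≤ k ≤ 10`.
Together with `not_rhatCell_of_five_le` / `not_rhatCell_five` / `not_rhatCell_six` (the slices `u ≤ k − 3` fail for `q` large)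
and `rhatCell_self` / `rhatCell_pred` (`u ≤ 1`), this is the slice map of Rule Q on the families `k = 5 … 10`; the
untruncated slices `u ≥ k − 1` remain item (3) of the record. Axioms: standard.
-/

namespace PercRepro

open Set Matroid Finset

/-- **The borderline slice for `k = 5 … 10`**: `Φ(q+k, q) ≤ R̂(q, k, q − (k−2))` for every `q ≥ k − 2`. -/
theorem rhat_borderline_of_le_ten (k q : ℕ) (hk5 : 5 ≤ k) (hk10 : k ≤ 10) (hq : k - 2 ≤ q) :
    phiK (q + k) q ≤ rhat q k (q - (k - 2)) := by
  interval_cases k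
  · exact rhat_five_slice_three_all q (by omega)
  · exact rhat_six_slice_four_all q (by omega)
  · exact rhat_seven_slice_five_all q (by omega)
  · exact rhat_eight_slice_six_all q (by omega)
  · exact rhat_nine_slice_seven_all q (by omega)
  · exact rhat_ten_slice_eight_all q (by omega)

variable {α : Type} (M : Matroid α) [M.Finite]

/-- **The matroid level**: at the tight layer of the cell `(q+k, q)`, `5 ≤ k ≤ 10`, every member `Z` with
`#(flatPart M Z) = q − (k − 2)` receives at least `Φ(q+k, q)` under Rule Q's equal split. -/
theorem ruleQRecv_ge_phiK_borderline {q k : ℕ} (hk5 : 5 ≤ k) (hk10 : k ≤ 10) (hq : k - 2 ≤ q)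
    (hE : M.E.ncard = (q + k) + q) {Z : Set α} (hZ : Z ∈ cellMembers M (q + k) q)
    (hP : (flatPart M Z).ncard = q - (k - 2)) :
    phiK (q + k) q ≤ ruleQRecv M (q + k) q Z := by
  have h1 := rhat_borderline_of_le_ten k q hk5 hk10 hq
  have h2 := rhat_le_ruleQRecv M hE hZ
  rw [hP] at h2
  exact h1.trans h2

end PercRepro
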